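import Literature.Topology.FourManifolds.Cobordism
import Literature.Topology.FourManifolds.Handles
import Literature.Geometry.Lorentzian.PseudoRiemannianMetric
import Literature.Geometry.Lorentzian.LeviCivita
import Literature.Geometry.Lorentzian.Hypersurface
import Literature.Geometry.Lorentzian.Isometry
import Literature.Geometry.Lorentzian.IsometryProofs
import Mathlib.Topology.Homotopy.Contractible
import HarnessLib

/-!
# Compact contractible manifolds carry PSC metrics with mean-convex boundary (Sweeney 2026, Prop. 1.2, after Lawson–Michelsohn 1984)

Topic `Geometry/Riemannian`; cite item `wi-17844` of route SmoothPoincare4/PscCorkFillIn (crux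
`MeanConvexTwistedPair`, `stmt-SmoothPoincare4-8131`: "each Mazur piece separately carries
mean-convex PSC metrics by LawsonMichelsohn1984 / Sweeney2026 Prop 1.2").

**Printed** (P. Sweeney Jr., *Positive curvature conditions on contractible manifolds*, Math. Ann.
(2026) = arXiv:2507.15719, p. 4 of the arXiv text, stated as a consequence of Lawson–Michelsohn,
*Embedding and surrounding with positive mean curvature*, Invent. Math. 77 (1984), no proof in
print): "**Proposition 1.2.** Let `X^{n+1}`, `n ≥ 2`, be a compact, contractible `(n+1)`-manifold
with boundary. If `n = 3`, additionally assume that `X` is a Mazur manifold. Then `X` supports a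
Riemannian metric with positive scalar curvature and mean convex boundary." with (ibid. §3, before
Prop. 3.9) "Given `(X^{n+1}, g)` a Riemannian manifold with boundary and `ν` the outward-pointing
unit normal to `∂X`. We define the second fundamental form `A_{∂X}(U,V) = ⟨∇_U ν, V⟩` … We say that
the boundary is mean convex if the mean curvature (i.e., the trace of `A_{∂X}`) is strictly
positive." and (ibid. App. A) "a Mazur manifold `X` is a compact, contractible 4-manifold with
boundary admitting a (smooth) handle decomposition with one 0-handle, one 1-handle, and one
2-handle."

**Rendering** — in the vocabulary in which the route states its items (copied clause by clause from
`MeanConvexTwistedPair`, so that the fact plugs in): `X` a compact (Hausdorff, second countable)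
contractible smooth `(n+1)`-manifold with boundary, `ChartedSpace (EuclideanHalfSpace (n + 1)) X`,
boundary datum `bX : BoundaryData (𝓡∂ (n + 1)) X (𝓡 n)` (`Topology/FourManifolds/Cobordism.lean`);
"Mazur" = `HasHandleDecomposition 3 X (fun k => if k ≤ 2 then 1 else 0)`
(`Topology/FourManifolds/Handles.lean`: an adapted Morse function with exactly one critical point of
each index `0, 1, 2` and none of higher index — Kosinski VII: handle presentations ⟺ Morse
functions); the metric is a `Literature.Geometry.Lorentzian.PseudoRiemannianMetric` on `TX` that
`IsRiemannian`, has a Levi-Civita connection, positive `scalarCurvature`, for which the boundary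
inclusion is a spacelike immersion with a smooth OUTWARD unit normal `ν` (first half-space coordinate
of `ν` negative) along which `meanCurvature > 0` — the tree's sign convention
`K_ν(v, w) = +g(D_v ν, df w)`, `H = tr K` (`Hypersurface.lean`: "for round spheres with the outward
normal `H = +2/r`") is Sweeney's `A_{∂X}(U, V) = ⟨∇_U ν, V⟩`, `H = tr A` with the outward normal.

* `Sweeney2026_pscMeanConvex` — Prop. 1.2 as printed (all `n ≥ 2`; the Mazur hypothesis only when
  `n = 3`), NAMED FACT;
* `Sweeney2026_pscMeanConvex.mazur` — PROVED specialisation: every Mazur manifold (compact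
  contractible smooth 4-manifold with a `(0,1,2)`-handle decomposition with one handle of each
  index) carries a PSC metric with mean-convex boundary — the per-piece clause of
  `MeanConvexTwistedPair` (with `<` in place of its `≤` on `H`).

NOT vendored: (i) Lawson–Michelsohn 1984 itself in the form the item's title asks for ("a compact
domain in the round `Sⁿ` with a handle decomposition into handles of index `≤ n - 2` is isotopic to
one with boundary of positive mean curvature"; their §3 / Thm. 1) — the paper is not held
(paywalled, acquisition request `acq-02463` open; no copy in the internal corpora) and no held
secondary source restates that theorem with its hypotheses, so only Sweeney's printed consequence is
recorded; the tree's `Literature.Geometry.Riemannian.LawsonMichelsohn1984_surrounding`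
(`MeanConvexSurrounding.lean`, their Thm. 6.1: Euclidean ambient space of dimension `≥ 5`, `1`-thin
domains) does NOT cover domains in `S⁴`; (ii) the constant-curvature-one strengthening and the
Bär–Hanke consequences (PSC with convex / totally geodesic / doubling boundary, Bär–Hanke 2023
Cor. 34) mentioned in Sweeney's text after Remark 1.3 — remarks, not numbered statements, and the
tree has no sectional curvature for `PseudoRiemannianMetric`.

## References

* P. Sweeney Jr., *Positive curvature conditions on contractible manifolds*, Math. Ann. (2026),
  doi:10.1007/s00208-026-03333-8 = arXiv:2507.15719: Prop. 1.2 (p. 4), §3 (second fundamental form,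
  mean convex), App. A (Mazur manifolds, Prop. A.1). [Sweeney2026]
* H. B. Lawson, M.-L. Michelsohn, *Embedding and surrounding with positive mean curvature*, Invent.
  Math. 77 (1984) 399–419. [LawsonMichelsohn1984]
* A. A. Kosinski, *Differential Manifolds* (1993), VII Thm. 1.1 (handle presentations and Morse
  functions). [Kosinski1993]
-/

noncomputable section

open scoped Manifold ContDiff Topology
open Set Function

namespace Literature.Geometry.Riemannian

/-- **Sweeney 2026, Prop. 1.2 (after Lawson–Michelsohn 1984; NAMED FACT): compact contractible
manifolds with boundary carry metrics of positive scalar curvature with mean-convex boundary.**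
"Let `X^{n+1}`, `n ≥ 2`, be a compact, contractible `(n+1)`-manifold with boundary. If `n = 3`,
additionally assume that `X` is a Mazur manifold. Then `X` supports a Riemannian metric with positive
scalar curvature and mean convex boundary" (mean convex: `H = tr A_{∂X} > 0` for the outward unit
normal, ibid. §3; Mazur: one `0`-, one `1`-, one `2`-handle, ibid. App. A). Rendered over
`BoundaryData` / `HasHandleDecomposition` / `PseudoRiemannianMetric` (`IsRiemannian`, `scalarCurvature`,
`meanCurvature` for the outward unit normal `ν`, `(ν z) 0 < 0` in the half-space model) exactly as in
the items of route SmoothPoincare4/PscCorkFillIn; see the module docstring. Printed without proof as a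
consequence of Lawson–Michelsohn (Invent. Math. 77 (1984)). [cite: Sweeney2026, Prop. 1.2] -/
def Sweeney2026_pscMeanConvex : Prop :=
  ∀ (n : ℕ), 2 ≤ n →
    ∀ (X : Type) [TopologicalSpace X] [T2Space X] [SecondCountableTopology X]
      [ChartedSpace (EuclideanHalfSpace (n + 1)) X] [IsManifold (𝓡∂ (n + 1)) ∞ X] [CompactSpace X]
      [ContractibleSpace X]
      (bX : Literature.Topology.FourManifolds.BoundaryData (𝓡∂ (n + 1)) X (𝓡 n)),
      (n = 3 → Literature.Topology.FourManifolds.HasHandleDecomposition n X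
        (fun k => if k ≤ 2 then 1 else 0)) →
      ∃ g : Literature.Geometry.Lorentzian.PseudoRiemannianMetric (𝓡∂ (n + 1)) ∞
          (EuclideanSpace ℝ (Fin (n + 1))) (TangentSpace (𝓡∂ (n + 1)) : X → Type _),
      ∃ _ : g.HasLeviCivita, ∃ hf : g.IsSpacelikeImmersion (𝓡 n) bX.incl,
      ∃ ν : Literature.Geometry.Lorentzian.NormalField (𝓡∂ (n + 1)) bX.incl,
        g.IsRiemannian ∧ (∀ x, 0 < g.scalarCurvature x) ∧ g.IsUnitNormal (𝓡 n) bX.incl ν 1 ∧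
        ContMDiff (𝓡 n) (𝓡∂ (n + 1)).tangent ∞
          (fun z ↦ (Bundle.TotalSpace.mk' (EuclideanSpace ℝ (Fin (n + 1))) (bX.incl z) (ν z) :
            TangentBundle (𝓡∂ (n + 1)) X)) ∧
        (∀ z, (show EuclideanSpace ℝ (Fin (n + 1)) from ν z) 0 < 0) ∧
        ∀ z, 0 < g.meanCurvature bX.incl
          Literature.Geometry.Lorentzian.PseudoRiemannianMetric.contMDiff_pullbackBilin_holds hf ν z

/-- **Mazur manifolds carry PSC metrics with mean-convex boundary** (Sweeney 2026, Prop. 1.2, the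
case `n = 3`; PROVED specialisation of the named fact): every compact contractible smooth 4-manifold
with boundary admitting a handle decomposition with one `0`-handle, one `1`-handle and one `2`-handle
supports a Riemannian metric of positive scalar curvature whose boundary has positive mean curvature
for the outward unit normal — the per-piece clause of crux `MeanConvexTwistedPair` of route
SmoothPoincare4/PscCorkFillIn (there with `0 ≤ H`; here the printed strict `0 < H`).
[cite: Sweeney2026, Prop. 1.2] -/
theorem Sweeney2026_pscMeanConvex.mazur (h : Sweeney2026_pscMeanConvex)
    (X : Type) [TopologicalSpace X] [T2Space X] [SecondCountableTopology X]
    [ChartedSpace (EuclideanHalfSpace 4) X] [IsManifold (𝓡∂ 4) ∞ X] [CompactSpace X]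
    [ContractibleSpace X] (bX : Literature.Topology.FourManifolds.BoundaryData (𝓡∂ 4) X (𝓡 3))
    (hM : Literature.Topology.FourManifolds.HasHandleDecomposition 3 X
      (fun k => if k ≤ 2 then 1 else 0)) :
    ∃ g : Literature.Geometry.Lorentzian.PseudoRiemannianMetric (𝓡∂ 4) ∞
        (EuclideanSpace ℝ (Fin 4)) (TangentSpace (𝓡∂ 4) : X → Type _),
    ∃ _ : g.HasLeviCivita, ∃ hf : g.IsSpacelikeImmersion (𝓡 3) bX.incl,
    ∃ ν : Literature.Geometry.Lorentzian.NormalField (𝓡∂ 4) bX.incl,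
      g.IsRiemannian ∧ (∀ x, 0 < g.scalarCurvature x) ∧ g.IsUnitNormal (𝓡 3) bX.incl ν 1 ∧
      ContMDiff (𝓡 3) (𝓡∂ 4).tangent ∞
        (fun z ↦ (Bundle.TotalSpace.mk' (EuclideanSpace ℝ (Fin 4)) (bX.incl z) (ν z) :
          TangentBundle (𝓡∂ 4) X)) ∧
      (∀ z, (show EuclideanSpace ℝ (Fin 4) from ν z) 0 < 0) ∧
      ∀ z, 0 < g.meanCurvature bX.incl
        Literature.Geometry.Lorentzian.PseudoRiemannianMetric.contMDiff_pullbackBilin_holds hf ν z :=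
  h 3 (by norm_num) X bX fun _ => hM

end Literature.Geometry.Riemannian

end
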